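import Summits.QuantumFields.GaugeBoot.StrongCouplingWords
import Summits.QuantumFields.GaugeBoot.StrongCouplingOneStep
import Summits.QuantumFields.GaugeBoot.WordRectangle
import HarnessLib

/-!
# Strong coupling from the loop equation, X: every rectangular Wilson loop is `O(β)` on every torus, explicitly (gauge-boot, ADDENDUM 22 part J)

HONEST FRAMING (cell `pub-gaugeboot`, page 1 of every file): the venture produces certified bounds
on lattice expectations at stated coupling, gauge group, dimension and torus size; NOT a mass gap,
NOT a continuum limit, NOT a string tension; NOT Yang–Mills-summit-bearing (barriers
`FixedCouplingUltralocality`, `PerturbativeInvisibility`).  An analytic STRONG-COUPLING bound with an explicit constant, uniform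
in the volume; much weaker than an area law (which it is not); informative only for small `|β_std|`.

## Content (`SU(N)`, `N ≥ 2`, fundamental representation, torus `(ℤ/L)^D`, `L ≥ 2`)

The rectangle word `(+e_i)^R (+e_j)^T (−e_i)^R (−e_j)^T` (`Word.rectangle`, cell ym-instrument's `WordRectangle`) traverses
its first edge `(x, i)` exactly once as soon as `1 ≤ R < L` and `1 ≤ T < L` (`avoids_rectangle_tail`: the straight segments
avoid `(x, i)` by the axis criterion or by one coordinate of `(ℤ/L)^D`), so the one-step bound of `StrongCouplingOneStep` applies:

* ★★★ `abs_wilsonLoopExpectation_le` — for `N ≥ 2`, `D ≥ 2`, `1 ≤ R < L`, `1 ≤ T < L` and EVERY real `β_std`: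
  **`|wilsonLoopExpectation N D L β_std R T| ≤ 4(D−1)|β_std|/(N²−1)`** — every rectangular Wilson loop of every torus is `O(β)` at
  strong coupling with the same explicit, volume-independent constant as the plaquette (`R = T = 1`).

References: M. Creutz, *Quarks, gluons and lattices* (1983) Ch. 10; Yu. Makeenko, *Methods of contemporary gauge theory* (2002)
§12.  Everything is `[folklore]`.
-/

noncomputable section

open MeasureTheory
open scoped Matrix
open Literature.MathematicalPhysics.QuantumFieldTheory Literature.MathematicalPhysics.QuantumLattice

namespace Summit.QuantumFields.GaugeBoot

namespace StrongCoupling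

variable {d L : ℕ}

/-! ## The straight segments avoid the marked edge -/

/-- A straight forward segment along an axis other than `i` avoids `(x, i)`. [folklore] -/
theorem avoids_line_of_ne (x y : Site d L) {i k : Fin d} (hki : k ≠ i) (n : ℕ) : Word.Avoids y (Word.line k n) (x, i) := by
  induction n generalizing y with
  | zero => exact Word.avoids_nil _ _
  | succ n ih => rw [Word.line_succ]; exact Word.avoids_cons (Step.edge_ne_of_axis_ne hki) (ih _)

/-- A straight backward segment along an axis other than `i` avoids `(x, i)`. [folklore] -/
theorem avoids_replicate_bwd_of_ne (x y : Site d L) {i k : Fin d} (hki : k ≠ i) (n : ℕ) :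
    Word.Avoids y (List.replicate n (.bwd k)) (x, i) := by
  induction n generalizing y with
  | zero => exact Word.avoids_nil _ _
  | succ n ih => rw [List.replicate_succ]; exact Word.avoids_cons (Step.edge_ne_of_axis_ne hki) (ih _)

/-- In `ℤ/L`: a natural number `0 < m < L` is nonzero. [folklore] -/
theorem natCast_zmod_ne_zero {m : ℕ} (hm0 : 0 < m) (hmL : m < L) : ((m : ℕ) : ZMod L) ≠ 0 := by
  rw [Ne, ZMod.natCast_eq_zero_iff]
  exact Nat.not_dvd_of_pos_of_lt hm0 hmL

/-- **The forward segment along `i` started at `x + m e_i` avoids `(x, i)`** as long as it does not wrap around: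
`1 ≤ m` and `m + n ≤ L`. [folklore] -/
theorem avoids_line_same [NeZero L] (x : Site d L) (i : Fin d) :
    ∀ {m n : ℕ}, 1 ≤ m → m + n ≤ L → Word.Avoids (x + Pi.single i ((m : ℕ) : ZMod L)) (Word.line i n) (x, i)
  | m, 0, _, _ => Word.avoids_nil _ _
  | m, n + 1, hm, hmn => by
    rw [Word.line_succ]
    refine Word.avoids_cons (Step.fwd_edge_ne (site_ne_of_apply_ne i ?_)) ?_
    · simp only [Pi.add_apply, Pi.single_eq_same, ne_eq, add_eq_left]
      exact natCast_zmod_ne_zero hm (by omega)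
    · have e : (Step.fwd i).apply (x + Pi.single i ((m : ℕ) : ZMod L)) = x + Pi.single i (((m + 1 : ℕ) : ℕ) : ZMod L) := by
        simp only [Step.apply_fwd, Site.shift, Nat.cast_succ, Pi.single_add]; abel
      rw [e]
      exact avoids_line_same x i (by omega) (by omega)

/-- **A backward segment along `i` whose sites have `j`-coordinate different from `x j` avoids `(x, i)`** (`i ≠ j`).
[folklore] -/
theorem avoids_replicate_bwd_same (x : Site d L) {i j : Fin d} (hij : i ≠ j) :
    ∀ (n : ℕ) {y : Site d L}, y j ≠ x j → Word.Avoids y (List.replicate n (.bwd i)) (x, i)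
  | 0, y, _ => Word.avoids_nil _ _
  | n + 1, y, hy => by
    rw [List.replicate_succ]
    have hy' : ((Step.bwd i).apply y) j ≠ x j := by
      simp only [Step.apply_bwd, Pi.sub_apply, Pi.single_eq_of_ne hij.symm, sub_zero]; exact hy
    exact Word.avoids_cons (Step.bwd_edge_ne (site_ne_of_apply_ne j hy')) (avoids_replicate_bwd_same x hij n hy')

/-- ★ **The rectangle word traverses its first edge once**: for `1 ≤ R`, `R < L`, `1 ≤ T < L`, `i ≠ j`, the tail
`(+e_i)^{R−1} (+e_j)^T (−e_i)^R (−e_j)^T` read from `x + e_i` avoids `(x, i)`. [folklore] -/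
theorem avoids_rectangle_tail [NeZero L] (x : Site d L) {i j : Fin d} (hij : i ≠ j) {R T : ℕ} (hR : R < L)
    (hT1 : 1 ≤ T) (hT : T < L) :
    Word.Avoids (x.shift i) (Word.line i R ++ Word.line j T ++ List.replicate (R + 1) (.bwd i) ++ List.replicate T (.bwd j))
      (x, i) := by
  have h1 : Word.Avoids (x.shift i) (Word.line i R) (x, i) := by
    have h := avoids_line_same x i (m := 1) (n := R) le_rfl (by omega)
    simpa [Site.shift] using h
  refine Word.avoids_append (Word.avoids_append (Word.avoids_append h1 (avoids_line_of_ne x _ hij.symm T)) ?_)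
    (avoids_replicate_bwd_of_ne x _ hij.symm T)
  refine avoids_replicate_bwd_same x hij (R + 1) ?_
  rw [Word.endpoint_append, Word.endpoint_line, Word.endpoint_line]
  simp only [Site.shift, Pi.add_apply, Pi.single_eq_same, Pi.single_eq_of_ne hij.symm, add_zero, ne_eq, add_eq_left]
  exact natCast_zmod_ne_zero hT1 hT

/-- The rectangle word with `R + 1` columns as `+e_i` followed by its tail. [folklore] -/
theorem rectangle_succ_eq (i j : Fin d) (R T : ℕ) :
    Word.rectangle i j (R + 1) T =
      .fwd i :: (Word.line i R ++ Word.line j T ++ List.replicate (R + 1) (.bwd i) ++ List.replicate T (.bwd j)) := by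
  simp [Word.rectangle, Word.line_succ]

/-! ## The bound -/

/-- ★★★ **EVERY RECTANGULAR WILSON LOOP IS `O(β)` AT STRONG COUPLING, EXPLICITLY.**  For `SU(N)`, `N ≥ 2`, `D ≥ 2`, a torus
side `L` with `1 ≤ R < L`, `1 ≤ T < L`, and EVERY real standard coupling `β_std`:
`|wilsonLoopExpectation N D L β_std R T| ≤ 4(D−1)|β_std|/(N²−1)`. [folklore] -/
theorem abs_wilsonLoopExpectation_le {N D L : ℕ} [NeZero L] (hN : 2 ≤ N) (hD : 2 ≤ D) {R T : ℕ} (hR1 : 1 ≤ R) (hR : R < L)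
    (hT1 : 1 ≤ T) (hT : T < L) (β : ℝ) :
    |wilsonLoopExpectation N D L β R T| ≤ 4 * ((D : ℝ) - 1) * |β| / ((N : ℝ) ^ 2 - 1) := by
  obtain ⟨i, j, hij⟩ : ∃ i j : Fin D, i ≠ j := ⟨⟨0, by omega⟩, ⟨1, by omega⟩, by simp [Fin.ext_iff]⟩
  have hL : (1 : ZMod L) ≠ 0 := zmod_one_ne_zero (by omega)
  have hNpos : (0 : ℝ) < N := by
    have : (2 : ℝ) ≤ N := by exact_mod_cast hN
    linarith
  have hN2 : (1 : ℝ) < ((fundamentalLatticeRep N).N : ℝ) ^ 2 := by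
    rw [fundamentalLatticeRep_N]
    have : (2 : ℝ) ≤ N := by exact_mod_cast hN
    nlinarith
  set x : Site D L := fun _ => 0
  obtain ⟨R', rfl⟩ : ∃ R', R = R' + 1 := ⟨R - 1, by omega⟩
  rw [wilsonLoopExpectation_eq_wordLoop N D L β (R' + 1) T x hij]
  have h := abs_wilsonExpectation_wordLoop_le (d := D) (L := L) (fundamentalLatticeRep N) (β / N) x i (s := 1) zero_le_one hN2
    (Word.rectangle i j (R' + 1) T) (Word.endpoint_rectangle x i j _ T)
    (fun U => by
      rw [Complex.ofReal_one, rectangle_succ_eq]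
      exact sum_splitTerm_cons_fwd (fundamentalRep (Fin N)) 1 x i U (avoids_rectangle_tail x hij (by omega) hT1 hT))
    (fun a b => by rw [Complex.ofReal_one]; exact sdPair_specialUnitaryGroup N _ x i x _ _ (trace_unitDir_one a b))
  simp only [fundamentalLatticeRep_N, fundamentalLatticeRep_ρ] at h
  refine h.trans (le_of_eq ?_)
  rw [abs_div, Nat.abs_cast]
  field_simp
  ring

/-- `SU(3)`, `D = 4`: `|wilsonLoopExpectation 3 4 L β R T| ≤ 3|β|/2` for `1 ≤ R, T < L` and every real `β`. [folklore] -/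
theorem abs_wilsonLoopExpectation_three_four_le {L : ℕ} [NeZero L] {R T : ℕ} (hR1 : 1 ≤ R) (hR : R < L) (hT1 : 1 ≤ T)
    (hT : T < L) (β : ℝ) : |wilsonLoopExpectation 3 4 L β R T| ≤ 3 * |β| / 2 := by
  have h := abs_wilsonLoopExpectation_le (N := 3) (D := 4) (L := L) (by norm_num) (by norm_num) hR1 hR hT1 hT β
  norm_num at h
  linarith

end StrongCoupling

end Summit.QuantumFields.GaugeBoot

end
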